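import Summits.QuantumFields.YangMills.Theorems.BalabanUVNodesN06SectDUnitsAtPins
import Literature.MathematicalPhysics.QuantumFieldTheory.Balaban1983to89.Node00.OpsYGpUnits
import Literature.MathematicalPhysics.QuantumFieldTheory.Balaban1983to89.B9Thm312WholeIdentitiesDefAtPins
import Literature.MathematicalPhysics.QuantumFieldTheory.Balaban1983to89.B9PerturbationMajorantsAtLettersPhys
import Summits.QuantumFields.YangMills.Theorems.BalabanUVNodesN06SectDUnitsAtPinsPhys
import Literature.MathematicalPhysics.QuantumFieldTheory.Balaban1983to89.Node00.OpsYSectDCoordsQ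
import Literature.MathematicalPhysics.QuantumFieldTheory.Balaban1983to89.Node00.OpsYRecordV10

/-!
# BalabanUVNodes ∕ N06 ([B9], `Dag.B9_main`) — CASCADE-K «K3-D» (director-ym №383): THE TEN DEFINITIONAL SECT.-D IDENTITIES `IdentitiesDef 𝔬 U` AT THE PHYS PINS OVER A
# GENERIC AVERAGING PAIR `(𝔮, 𝔮⋆)` AND SITE TRANSPORTER `parS` — `identitiesDef_of_pins_physQ`, the `𝔮`-generic edition of this seat's `…N06SectDUnitsAtPinsPhys.identitiesDef_of_pins_phys`

Track A of `YM-PLAN.md` (cell `pub-ymgap`, HUMAN RULING D-0062), node **N06**; seat `pub-ymgap-dag-n06-d` (g26).  WHY: the knit certificate's Sect.-D network «KD» (HOME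
`K3D-CENSUS-g25.md`) reads the ten fields `invG0′ ∕ invG ∕ invG1 ∕ eq126 ∕ eq129 ∕ eq153 ∕ c1_inv ∕ adjQ ∕ adjDv ∕ symmR` at node00-def-Y's `𝔮`-generic Sect.-D letters
(`Node00.OpsYSectDQ`: `deltaAQY ∕ GAQY ∕ deltaPiAQY ∕ GDQY ∕ deltaOneQY ∕ G1QY ∕ HDQY ∕ H1QY ∕ GGQY`) on the `𝔮`-generic coordinate models of `Node00.OpsYOps312OfRecordPar` §0
(`S0coKq ∕ QcoKHq ∕ QscoKHq ∕ CcoKq ∕ C1coKq`, the shapes of `pins312Par_of_eq`).  node00-def-Y g33's W6 `Node00.OpsYSectDCoordsQ` (✓p780815) re-pressed the seven identities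
and the two transposes ONCE over `(𝔮, 𝔮⋆, parS, G′, Δ⁽²⁾)` and printed the CONSUMER RECIPE; THIS FILE executes it: ★★★ `identitiesDef_of_pins_physQ` — the straight-pair
theorem's statement with every letter ∕ model swapped for its `𝔮`-generic twin, the Sect. A–C letter `G = Δ_a[𝔮]⁻¹` and its unit kept at the lattice `G′` (def-Y
`GAQY_GpPhysY ∕ deltaAQY_GpPhysY_eq` (`Node00/OpsYRecordV10`) — the SAME operators), and two displayed LAWS in place of the straight pair's built-in facts: `hadjQ` (the pair is
adjoint in the trace pairing at `U` — at print's knit pair `isAdjTr_qKnitOfRecord`, every `U`) and `hsymR` (`R(U; parS)` symmetric — at `parKnitY` regime-keyed, W6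
`isTransposePair_RcoK_parKnitY_SU_threshK`'s input).  At `(QY parBY, QsY parBY, parSymY)` the models are the straight ones by `rfl` (`S0coKq_QY` …) and this IS
`identitiesDef_of_pins_phys`.

HONEST FRAMING.  Finite-dimensional linear algebra over landed letters (proof = the straight proof with W6's lemma names); the four units stay HYPOTHESES (rows 20–21's
form smallness, `…SectDUnitsAtPinsPhysQ`); helper, COUNT-NEUTRAL; nothing of [B9] asserted; N06 NOT discharged.  One finite 𝕋⁴ programme at fixed `ε` — NOT continuum, NOT OS,
NOT the mass gap ∕ Clay.  0 `def`, 0 `sorry`.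
-/

noncomputable section

namespace Summit.QuantumFields.YangMills.BalabanUVNodes.N06SectDIdentitiesAtPinsPhysQ

open Literature.MathematicalPhysics.QuantumFieldTheory.Balaban1983to89
open Literature.MathematicalPhysics.QuantumFieldTheory.Balaban1983to89.Node00
open Literature.MathematicalPhysics.QuantumFieldTheory.Balaban1983to89.Node00.OpsYSectDCoords (S0coK TpicoK T2coK cR39_trBasis_pos coordOpK_sub coordOpK_add repr_assembleK)
open Literature.MathematicalPhysics.QuantumFieldTheory.Balaban1983to89.B9CoReadingCoords (XBK assembleK coordOpK coordOpK_apply)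
open Literature.MathematicalPhysics.QuantumFieldTheory.Balaban1983to89.B9CoReadingCoordsTranspose
  (TrIdx trBasis trReForm trReForm_apply assembleK_pairing sum_trReForm_eq_trIP trBasis_repr_eq_trace)
open Literature.MathematicalPhysics.QuantumFieldTheory.Balaban1983to89.B9Thm39ReadingCoords (cR39)
open Literature.MathematicalPhysics.QuantumFieldTheory.Balaban1983to89.B9Thm312Whole (Ops FormSmall PosDefEnd)
open Literature.MathematicalPhysics.QuantumFieldTheory.Balaban1983to89.B9Thm311ReadingCoords (isUnit_of_injective trIP PosDefTr)
open Literature.MathematicalPhysics.QuantumFieldTheory.Balaban1983to89.B9Eq3132SectDLetters (deltaPiAY)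
open Literature.MathematicalPhysics.QuantumFieldTheory.Balaban1983to89.B6KLevelCensusIndexV1 (KIdx)
open Summit.QuantumFields.YangMills.BalabanUVNodes.N06SectDUnitsAtPins (injective_sub_of_form_bound injective_of_coordOpK_const injective_of_smul_injective
  dotProduct_coordOpK_const_eq_sum_trIP posDefTr_of_posDefEnd_coordOpK_const)
open Literature.MathematicalPhysics.QuantumFieldTheory.Balaban1983to89.Node00.OpsYSectDCoords
open Literature.MathematicalPhysics.QuantumFieldTheory.Balaban1983to89.B9Thm312WholeIdentitiesSplit (IdentitiesDef)
open Literature.MathematicalPhysics.QuantumFieldTheory.Balaban1983to89.B9Thm312Whole (frakPstar)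
open Literature.MathematicalPhysics.QuantumFieldTheory.Balaban1983to89.B9CoReadingCoords (GcoK)
open Literature.MathematicalPhysics.QuantumFieldTheory.Balaban1983to89.B9Eq3132SectDLetters (GDY QGQY QGQinvY HDY)
open Literature.MathematicalPhysics.QuantumFieldTheory.Balaban1983to89.B9CoReadingCoordsH (XHK HcoK)
open Literature.MathematicalPhysics.QuantumFieldTheory.Balaban1983to89.B9CoReadingCoordsS (XSK)
open Literature.MathematicalPhysics.QuantumFieldTheory.Balaban1983to89.B9Thm37Glue (IsTransposePair)
open scoped Matrix
open scoped Matrix.Norms.L2Operator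

open Literature.MathematicalPhysics.QuantumFieldTheory.Balaban1983to89.Node00.OpsYSectDCoordsQ (GcoK_GAQY_mul_S0coKq S0coKq_sub_TpicoK_mul_GcoK_GDQY S0coKq_sub_mul_GcoK_G1QY HcoK_HDQY_eq HcoK_H1QY_eq
  QcoKHq_G1_Qs_C1_eq_id GcoK_GGQY_eq_frakPstar isTransposePair_QcoKHq_QscoKHq isTransposePair_RcoK_of_isSymmTr)
open Literature.MathematicalPhysics.QuantumFieldTheory.Balaban1983to89.Node00.OpsYOps312OfRecordPar (S0coKq QcoKHq QscoKHq CcoKq C1coKq)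
open Literature.MathematicalPhysics.QuantumFieldTheory.Balaban1983to89.Node00.OpsYQLetter (QLetterY QsLetterY)

variable {N : ℕ} {d ℓ : ℕ} {hd : 1 ≤ d + 1} {hL : Odd (ℓ + 1) ∧ 1 < ℓ + 1} {b₀ b₁ : ℝ}

/-- ★★★ **THE TEN DEFINITIONAL SECT.-D IDENTITIES AT THE PHYS PINS OVER A GENERIC AVERAGING PAIR `(𝔮, 𝔮⋆)` AND SITE TRANSPORTER `parS`** (node00-def-Y W6 `OpsYSectDCoordsQ` CONSUMER RECIPE executed on the straight-pair theorem `…N06SectDUnitsAtPinsPhys.identitiesDef_of_pins_phys`: `S0coK ↦ S0coKq`, `QcoKH ↦ QcoKHq`, `QscoKH ↦ QscoKHq`, `CcoK ↦ CcoKq`, `C1coK ↦ C1coKq`, `GAY ↦ GAQY`, `GDY ↦ GDQY`, `G1Y ↦ G1QY`, `GGY ↦ GGQY`, `HDY ↦ HDQY`, `H1Y ↦ H1QY`, `QGQOfY parB ↦ QGQOfQY 𝔮 𝔮s`, W6 lemmas for their §6∕§7 namesakes; `adjQ` from the displayed `hadjQ`, `symmR` from the displayed `hsymR`; at `(QY parBY,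 QsY parBY, parSymY)` it IS the straight theorem). ORIGINAL DOCSTRING:: n06-l's `identitiesDef_of_pins` with the Sect.-D letters read at `G′_phys = GpPhysY i (parSymY i)`
and the Sect. A–C letter `G = Δ_a⁻¹` and its unit `hUa` kept at the lattice letter (the SAME operators, def-Y `GAY_GpPhysY ∕ deltaAY_GpPhysY` — the shapes the
certificate's `hG0co12` pin and `hΔA` display); the three inverse identities from the three units, (3.126)∕(3.129)∕(3.153)∕`c1_inv` by def-Y's `G′`-generic
algebra, the three transposes over `trBasis N`.
[cite: Balaban1985BackgroundPropagators, (3.122)–(3.132) pp.420–422, (3.153) p.426, Thm 3.11 p.416] -/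
theorem identitiesDef_of_pins_physQ (i : KIdx d ℓ hd hL b₀ b₁) (B : B9.Backgrounds) (cfg : B.Cfg → CfgY (Matrix (Fin N) (Fin N) ℂ) i)
    (𝔮 : QLetterY (Matrix (Fin N) (Fin N) ℂ) i) (𝔮s : QsLetterY (Matrix (Fin N) (Fin N) ℂ) i) (parS : SiteParY (Matrix (Fin N) (Fin N) ℂ) i)
    (Δ2 : BondOpY (Matrix (Fin N) (Fin N) ℂ) i) {g : B9.Geometry} {Y : Type}
    (𝔬 : Ops g B (XBK (TrIdx N) i) Y (XHK (TrIdx N) i) (XSK (TrIdx N) i)) (U₁ : B.Cfg) (hN : 0 < N)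
    {G : Subgroup (Matrix (Fin N) (Fin N) ℂ)ˣ} (hG : G ≤ B7Prop2Explicit.unitaryUnits (Matrix (Fin N) (Fin N) ℂ))
    (hU : ∀ μ x, cfg U₁ μ x ∈ G)
    -- [CASCADE-K «K3-D»] the two pair∕transporter LAWS (node00-def-Y W6 CONSUMER RECIPE): `(𝔮, 𝔮⋆)` adjoint in the trace pairing at `U` (knit: `isAdjTr_qKnitOfRecord`, every `U`), `R(U; parS)` symmetric (knit: regime-keyed)
    (hadjQ : B9Thm311ReadingCoords.IsAdjTr (fun _ => (1 : ℝ)) (fun _ => (1 : ℝ)) (𝔮 (cfg U₁)) (𝔮s (cfg U₁)))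
    (hsymR : B9Thm311ReadingCoords.IsSymmTr (fun _ => (1 : ℝ)) (RY i parS (GpPhysY i parS) (cfg U₁)))
    (hUa : IsUnit (deltaAQY i 𝔮 𝔮s parS (GpY i parS) (cfg U₁)))
    (hUπ : IsUnit (deltaPiAQY i 𝔮 𝔮s parS (GpPhysY i parS) (cfg U₁)))
    (hU1 : IsUnit (deltaOneQY i 𝔮 𝔮s parS (GpPhysY i parS) Δ2 (cfg U₁)))
    (hUQ : IsUnit (QGQOfQY i 𝔮 𝔮s (G1QY i 𝔮 𝔮s parS (GpPhysY i parS) Δ2) (cfg U₁)))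
    (hG0 : 𝔬.G0 U₁ = GcoK i (trBasis N) B cfg (GAQY i 𝔮 𝔮s parS (GpY i parS)) U₁)
    (hS0 : 𝔬.S0 U₁ = S0coKq i (trBasis N) B cfg 𝔮 𝔮s parS (GpPhysY i parS) U₁)
    (hTpi : 𝔬.Tpi U₁ = TpicoK i (trBasis N) B cfg parS (GpPhysY i parS) U₁)
    (hT2 : 𝔬.T2 U₁ = T2coK i (trBasis N) B cfg parS (GpPhysY i parS) Δ2 U₁)
    (hGD : 𝔬.G U₁ = GcoK i (trBasis N) B cfg (GDQY i 𝔮 𝔮s parS (GpPhysY i parS)) U₁)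
    (hG1 : 𝔬.G1 U₁ = GcoK i (trBasis N) B cfg (G1QY i 𝔮 𝔮s parS (GpPhysY i parS) Δ2) U₁)
    (hGG : 𝔬.GG U₁ = GcoK i (trBasis N) B cfg (GGQY i 𝔮 𝔮s parS (GpPhysY i parS) Δ2) U₁)
    (hQ : 𝔬.Q U₁ = QcoKHq i (trBasis N) B cfg 𝔮 U₁)
    (hQs : 𝔬.Qstar U₁ = QscoKHq i (trBasis N) B cfg 𝔮s U₁)
    (hC : 𝔬.C U₁ = CcoKq i (trBasis N) B cfg 𝔮 𝔮s parS (GpPhysY i parS) U₁)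
    (hC1 : 𝔬.C1 U₁ = C1coKq i (trBasis N) B cfg 𝔮 𝔮s parS (GpPhysY i parS) Δ2 U₁)
    (hHm : 𝔬.Hm U₁ = HcoK i (trBasis N) B cfg (HDQY i 𝔮 𝔮s parS (GpPhysY i parS)) U₁)
    (hH1m : 𝔬.H1m U₁ = HcoK i (trBasis N) B cfg (H1QY i 𝔮 𝔮s parS (GpPhysY i parS) Δ2) U₁)
    (hDv : 𝔬.Dv U₁ = DvcoKH i (trBasis N) B cfg U₁)
    (hDvs : 𝔬.Dvstar U₁ = DvscoKH i (trBasis N) B cfg U₁)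
    (hR : 𝔬.R U₁ = RcoK i (trBasis N) B cfg parS (GpPhysY i parS) U₁) :
    IdentitiesDef 𝔬 U₁ := by
  have hc : cR39 (trBasis N) ≠ 0 := (cR39_trBasis_pos hN).ne'
  have hUu : ∀ μ x, ((cfg U₁ μ x : (Matrix (Fin N) (Fin N) ℂ)ˣ) : Matrix (Fin N) (Fin N) ℂ) ∈ unitary (Matrix (Fin N) (Fin N) ℂ) :=
    fun μ x => B7Prop2Explicit.mem_unitaryUnits.mp (hG (hU μ x))
  refine
    { invG0' := ?_
      invG := ?_
      invG1 := ?_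
      eq126 := ?_
      eq129 := ?_
      eq153 := ?_
      c1_inv := ?_
      adjQ := ?_
      adjDv := ?_
      symmR := ?_ }
  · rw [hG0, hS0, ← GAQY_GpPhysY i 𝔮 𝔮s parS]
    exact GcoK_GAQY_mul_S0coKq hc ((deltaAQY_GpPhysY_eq i 𝔮 𝔮s parS (cfg U₁)).symm ▸ hUa)
  · rw [hS0, hTpi, hGD]
    exact S0coKq_sub_TpicoK_mul_GcoK_GDQY hc hUπ
  · rw [hS0, hTpi, hT2, hG1]
    exact S0coKq_sub_mul_GcoK_G1QY hc hU1
  · rw [hHm, hGD, hQs, hC]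
    exact HcoK_HDQY_eq hc U₁
  · rw [hH1m, hG1, hQs, hC1]
    exact HcoK_H1QY_eq hc U₁
  · rw [frakPstar, hGG, hG1, hQs, hC1, hQ, hDv, hR, hDvs]
    exact GcoK_GGQY_eq_frakPstar hc U₁
  · rw [hQ, hG1, hQs, hC1]
    exact QcoKHq_G1_Qs_C1_eq_id hc hUQ
  · rw [hQ, hQs]
    exact isTransposePair_QcoKHq_QscoKHq i B cfg U₁ 𝔮 𝔮s hadjQ
  · rw [hDv, hDvs]
    exact isTransposePair_DvcoKH_DvscoKH i B cfg U₁ hUu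
  · rw [hR]
    exact isTransposePair_RcoK_of_isSymmTr i B cfg U₁ parS (GpPhysY i parS) hsymR

end Summit.QuantumFields.YangMills.BalabanUVNodes.N06SectDIdentitiesAtPinsPhysQ

end
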